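import Summits.CriticalPhenomena.PercolationContinuityZ3.Theorems.Transplant.FKConnectivityAllQAntipodalAndGenWeightPath
import HarnessLib

/-!
# Connectivity correlation inequalities for `φ_{w,q}`, every `q > 0` — file 47a: TWO-SIDED DRIFTS — the master AND theorem in ROOTLESS and
# VIRTUAL-ROOT form, the PAIRING LEMMA, and the doubled root for a general two-sided drift (towards the `q`-free level-3 inequality `x ∧ (y ∨ z)`)

Support file (`--supports stmt-CriticalPhenomena-4575`), FK sub-lane `prim-bschramm-fk-2` (gen 22); builds on p205010 (kernel theorem,
internal audit signed; external expert review pending).  No definitions, no named facts, no sorries; standard axioms.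

THE PROGRAMME (memo FROM-fk-2-g22, FK-Q2 §31).  Gen 21's Conjecture `C_∞⁺` (`Z_H(z,q)² Cov_{φ_{z,q}}(f,g) ∈ (q−1)·ℝ≥0[z,q]` on series–parallel
graphs) is a kernel theorem for `f` on ≤ 2 edges and for the AND/OR type (`…AntipodalAndPlus`); at level 3 two odd types remain, `x∧(y∨z)` and
`maj₃`.  Rooted at `x = st`, the `x∧(y∨z)` functional is a sum of THREE two-sided drifts
`O(N; y, z; C) = D(yzC | C) + D(zC | yC) + D(yC | zC)`, `D(A | B) = ∑_{γ ⊆ N} (w(k(γ∪A∪st)+k((N\γ)∪B)) − w(k((N\γ)∪A∪st)+k(γ∪B))) h(γ)`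
(`A` attached on the rooted side, `B` on the other).  Gen 19/21's junction identities hold for ARBITRARY `(A, B)`; at a junction that separates
`y` from `z` the three drifts REGROUP ACROSS each other into instances of the master weighted AND theorem (`…AndGenWeightPath`):
`D(yC₁|C₁) + D(C₁|yC₁)` on side 1 is the U-drift of the free set `N₁ ∪ {y}` (this file's PAIRING LEMMA `FK.twoSidedW_pair_insert_eq`), the
remaining terms are AND-contracted, rootless and contracted-root drifts.  This file supplies the side inputs in the generality needed:
* `FK.andGenW_rootless_nonpos_of_isTTSP`, `FK.andGenW_virt_nonpos_of_isTTSP` — the master theorem WITHOUT a root and with a VIRTUAL root that may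
  be an edge of the network (inside `…AndGenWeightPath` these are the internal steps `rootless` / `virt`; here for networks of any size);
* `FK.twoSidedW_swap` (a rootless two-sided drift is antisymmetric in `(A, B)`), `FK.twoSidedW_pair_insert_eq` (+ rootless form);
* `FK.twoSidedW_doubled_eq` / `FK.twoSidedW_doubled_rem_nonpos` — the doubled-root decomposition of gen 19 for a general `(A | B)`: the
  remainder is termwise `≤ 0` for every antitone `w` (no nesting `B ⊆ A` needed).
[cite: Grimmett2006, §1.4 eq. (1.20) (p. 15); §3.8 Thm. (3.90) (pp. 61–62); §3.9 (pp. 63–64)] [cite: Wagner2006, Thm. 5.8(d), §5.3]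
-/

noncomputable section

namespace Summit.CriticalPhenomena.PercolationContinuityZ3.Theorems

namespace FK

open SimpleGraph Literature.Probability.LatticeModels Literature.Probability.Percolation
open scoped Classical

variable {V : Type*} [Fintype V]

section OrAttSides

/-- **The master weighted AND theorem, ROOTLESS form.**  `F` TTSP between `u, v`, `N ⊆ F` free, `A ⊆ F ∪ {uv}` attached on the first side,
`C ⊆ A` on the second, `N ∩ A = ∅`, `w` antitone, `h` monotone on the subsets of `N` ⟹
`∑_{γ ⊆ N} (w(k(γ∪A)+k((N\γ)∪C)) − w(k((N\γ)∪A)+k(γ∪C))) h(γ) ≤ 0`.  (Re-root the 2-connected graph `F ∪ {uv}` at any edge of `A \ C`.)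
[cite: Grimmett2006, §3.8 Thm. (3.90) (pp. 61–62); §3.9 (pp. 63–64)] [cite: Wagner2006, Thm. 5.8(d), §5.3] -/
theorem andGenW_rootless_nonpos_of_isTTSP {F : Finset (Sym2 V)} {u v : V} {N A C : Finset (Sym2 V)} (hFT : IsTTSP F u v)
    (hN : N ⊆ F) (hA : A ⊆ insert s(u, v) F) (hCA : C ⊆ A) (hNA : Disjoint N A)
    {w : ℕ → ℝ} (hw : ∀ k : ℕ, w (k + 1) ≤ w k)
    {h : Finset (Sym2 V) → ℝ} (hm : ∀ ⦃X Y : Finset (Sym2 V)⦄, X ⊆ Y → Y ⊆ N → h X ≤ h Y) :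
    ∑ γ ∈ N.powerset,
        (w (clusterCount (↑(γ ∪ A) : BondConfig V) ∅ + clusterCount (↑(N \ γ ∪ C) : BondConfig V) ∅) -
          w (clusterCount (↑(N \ γ ∪ A) : BondConfig V) ∅ + clusterCount (↑(γ ∪ C) : BondConfig V) ∅)) * h γ ≤ 0 := by
  by_cases hAC : A = C
  · subst hAC; exact (andGenW_rootless_self w N A h).le
  · obtain ⟨e, he⟩ : (A \ C).Nonempty := by
      rw [Finset.nonempty_iff_ne_empty, Ne, Finset.sdiff_eq_empty_iff_subset]
      exact fun hh => hAC (le_antisymm hh hCA)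
    revert he
    refine Sym2.ind (fun x y => ?_) e
    intro he
    have hxA : s(x, y) ∈ A := (Finset.mem_sdiff.1 he).1
    have hxC : s(x, y) ∉ C := (Finset.mem_sdiff.1 he).2
    by_cases hN0 : N = ∅
    · subst hN0; exact (andGenW_rootless_sum_empty w A C h).le
    · have hxF : s(x, y) ∈ insert s(u, v) F := hA hxA
      have hne : insert s(u, v) F ≠ {s(x, y)} := by
        intro hh
        obtain ⟨f, hf⟩ := Finset.nonempty_iff_ne_empty.2 hN0
        have hf' : f ∈ ({s(x, y)} : Finset (Sym2 V)) := hh ▸ Finset.mem_insert_of_mem (hN hf)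
        rw [Finset.mem_singleton] at hf'
        exact Finset.disjoint_left.1 hNA hf (hf' ▸ hxA)
      have hE' : IsTTSP ((insert s(u, v) F).erase s(x, y)) x y := hFT.reroot_erase hxF hne
      have key := andGenW_drift_nonpos_of_isTTSP _ le_rfl hE' (Finset.notMem_erase _ _) (N := N) (A := A.erase s(x, y)) (C := C)
        (fun f hf => Finset.mem_erase.2 ⟨fun hh => Finset.disjoint_left.1 hNA hf (hh ▸ hxA), Finset.mem_insert_of_mem (hN hf)⟩)
        (fun f hf => Finset.mem_erase.2 ⟨(Finset.mem_erase.1 hf).1, hA (Finset.mem_of_mem_erase hf)⟩)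
        (fun f hf => Finset.mem_erase.2 ⟨fun hh => hxC (hh ▸ hf), hCA hf⟩)
        (Finset.disjoint_of_subset_right (Finset.erase_subset _ _) hNA) w hw h hm
      have hins : ∀ X : Finset (Sym2 V), insert s(x, y) (X ∪ A.erase s(x, y)) = X ∪ A := fun X => by
        rw [← Finset.union_insert, Finset.insert_erase hxA]
      simp_rw [hins] at key
      exact key

/-- **The master weighted AND theorem with a VIRTUAL root.**  `F` TTSP between `u, v` (the root `uv` MAY be an edge of `F`), `N ⊆ F` free,
`A ⊆ F` attached, `C ⊆ A` contracted, `N ∩ A = ∅`, `w` antitone, `h` monotone ⟹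
`∑_{γ ⊆ N} (w(k(γ∪A∪uv)+k((N\γ)∪C)) − w(k((N\γ)∪A∪uv)+k(γ∪C))) h(γ) ≤ 0`.  (Root outside `F`: the master theorem; root attached: rootless form; root
free: doubled-root decomposition; root deleted: the master theorem on `F \ uv`.)
[cite: Grimmett2006, §3.8 Thm. (3.90) (pp. 61–62); §3.9 (pp. 63–64)] [cite: Wagner2006, Thm. 5.8(d), §5.3] -/
theorem andGenW_virt_nonpos_of_isTTSP {F : Finset (Sym2 V)} {u v : V} {N A C : Finset (Sym2 V)} (hFT : IsTTSP F u v)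
    (hN : N ⊆ F) (hA : A ⊆ F) (hCA : C ⊆ A) (hNA : Disjoint N A)
    {w : ℕ → ℝ} (hw : ∀ k : ℕ, w (k + 1) ≤ w k)
    {h : Finset (Sym2 V) → ℝ} (hm : ∀ ⦃X Y : Finset (Sym2 V)⦄, X ⊆ Y → Y ⊆ N → h X ≤ h Y) :
    ∑ γ ∈ N.powerset,
        (w (clusterCount (↑(insert s(u, v) (γ ∪ A)) : BondConfig V) ∅ + clusterCount (↑(N \ γ ∪ C) : BondConfig V) ∅) -
          w (clusterCount (↑(insert s(u, v) (N \ γ ∪ A)) : BondConfig V) ∅ + clusterCount (↑(γ ∪ C) : BondConfig V) ∅)) * h γ ≤ 0 := by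
  by_cases huvF : s(u, v) ∈ F
  swap
  · exact andGenW_drift_nonpos_of_isTTSP _ le_rfl hFT huvF hN hA hCA hNA w hw h hm
  by_cases huvA : s(u, v) ∈ A
  · have hins : ∀ X : Finset (Sym2 V), insert s(u, v) (X ∪ A) = X ∪ A := fun X =>
      Finset.insert_eq_of_mem (Finset.mem_union_right _ huvA)
    simp_rw [hins]
    exact andGenW_rootless_nonpos_of_isTTSP hFT hN (hA.trans (Finset.subset_insert _ _)) hCA hNA hw hm
  by_cases huvN : s(u, v) ∈ N
  · by_cases hF1 : F = {s(u, v)}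
    · have hN' : N.erase s(u, v) = ∅ := Finset.eq_empty_of_forall_notMem fun f hf => by
        have hfF := hN (Finset.mem_of_mem_erase hf)
        rw [hF1, Finset.mem_singleton] at hfF
        exact (Finset.mem_erase.1 hf).1 hfF
      refine andGenW_doubled hw huvN ?_ ?_ hm
      · intro h' _
        rw [hN']
        exact (andGenW_sum_empty w A C _ h').le
      · intro h' _
        rw [hN', Finset.powerset_empty, Finset.sum_singleton, Finset.empty_sdiff, Finset.empty_union, Finset.empty_union,
          sub_self, zero_mul]
    · have hE' : IsTTSP (F.erase s(u, v)) u v := hFT.erase_terminal_edge huvF hF1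
      refine andGenW_doubled hw huvN ?_ ?_ hm
      · intro h' hm'
        exact andGenW_drift_nonpos_of_isTTSP _ le_rfl hE' (Finset.notMem_erase _ _) (Finset.erase_subset_erase _ hN)
          (fun f hf => Finset.mem_erase.2 ⟨fun hh => huvA (hh ▸ hf), hA hf⟩) hCA
          (Finset.disjoint_of_subset_left (Finset.erase_subset _ _) hNA) w hw h' hm'
      · intro h' hm'
        have key := andGenW_rootless_nonpos_of_isTTSP hFT ((Finset.erase_subset _ _).trans hN) (A := insert s(u, v) A)
          (C := insert s(u, v) C) (Finset.insert_subset_insert _ hA) (Finset.insert_subset_insert _ hCA)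
          (Finset.disjoint_insert_right.2 ⟨Finset.notMem_erase _ _,
            Finset.disjoint_of_subset_left (Finset.erase_subset _ _) hNA⟩) hw hm'
        simp_rw [Finset.union_insert] at key
        exact key
  · by_cases hF1 : F = {s(u, v)}
    · have hN' : N = ∅ := Finset.eq_empty_of_forall_notMem fun f hf => by
        have hfF := hN hf
        rw [hF1, Finset.mem_singleton] at hfF
        exact huvN (hfF ▸ hf)
      rw [hN']
      exact (andGenW_sum_empty w A C _ h).le
    · exact andGenW_drift_nonpos_of_isTTSP _ le_rfl (hFT.erase_terminal_edge huvF hF1) (Finset.notMem_erase _ _)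
        (fun f hf => Finset.mem_erase.2 ⟨fun hh => huvN (hh ▸ hf), hN hf⟩)
        (fun f hf => Finset.mem_erase.2 ⟨fun hh => huvA (hh ▸ hf), hA hf⟩) hCA hNA w hw h hm

omit [Fintype V] in
/-- **A rootless two-sided drift is antisymmetric in its two attached sets**: the `(A | B)` and `(B | A)` sums cancel termwise. [folklore] -/
theorem twoSidedW_swap (w : ℕ → ℝ) (N A B : Finset (Sym2 V)) (h : Finset (Sym2 V) → ℝ) :
    ∑ γ ∈ N.powerset,
        (w (clusterCount (↑(γ ∪ A) : BondConfig V) ∅ + clusterCount (↑(N \ γ ∪ B) : BondConfig V) ∅) -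
          w (clusterCount (↑(N \ γ ∪ A) : BondConfig V) ∅ + clusterCount (↑(γ ∪ B) : BondConfig V) ∅)) * h γ +
      ∑ γ ∈ N.powerset,
        (w (clusterCount (↑(γ ∪ B) : BondConfig V) ∅ + clusterCount (↑(N \ γ ∪ A) : BondConfig V) ∅) -
          w (clusterCount (↑(N \ γ ∪ B) : BondConfig V) ∅ + clusterCount (↑(γ ∪ A) : BondConfig V) ∅)) * h γ = 0 := by
  rw [← Finset.sum_add_distrib]
  refine Finset.sum_eq_zero fun γ _ => ?_
  rw [add_comm (clusterCount (↑(γ ∪ B) : BondConfig V) ∅), add_comm (clusterCount (↑(N \ γ ∪ B) : BondConfig V) ∅)]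
  ring

omit [Fintype V] in
/-- **THE PAIRING LEMMA (rooted).**  For `y ∉ N`: the two-sided drifts `(A ∪ y | B)` and `(A | B ∪ y)` of the free set `N` (root `e`) add up to the
drift `(A | B)` of the free set `N ∪ {y}` against the test function `h(· \ y)` — i.e. `y` becomes a FREE edge not read by the test function.
[cite: Grimmett2006, §1.4 eq. (1.20) (p. 15)] -/
theorem twoSidedW_pair_insert_eq (w : ℕ → ℝ) {N : Finset (Sym2 V)} (A B : Finset (Sym2 V)) (e : Sym2 V) {y : Sym2 V} (hy : y ∉ N)
    (h : Finset (Sym2 V) → ℝ) :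
    ∑ γ ∈ N.powerset,
        (w (clusterCount (↑(insert e (γ ∪ insert y A)) : BondConfig V) ∅ + clusterCount (↑(N \ γ ∪ B) : BondConfig V) ∅) -
          w (clusterCount (↑(insert e (N \ γ ∪ insert y A)) : BondConfig V) ∅ + clusterCount (↑(γ ∪ B) : BondConfig V) ∅)) * h γ +
      ∑ γ ∈ N.powerset,
        (w (clusterCount (↑(insert e (γ ∪ A)) : BondConfig V) ∅ + clusterCount (↑(N \ γ ∪ insert y B) : BondConfig V) ∅) -
          w (clusterCount (↑(insert e (N \ γ ∪ A)) : BondConfig V) ∅ + clusterCount (↑(γ ∪ insert y B) : BondConfig V) ∅)) * h γ =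
      ∑ γ ∈ (insert y N).powerset,
        (w (clusterCount (↑(insert e (γ ∪ A)) : BondConfig V) ∅ + clusterCount (↑(insert y N \ γ ∪ B) : BondConfig V) ∅) -
          w (clusterCount (↑(insert e (insert y N \ γ ∪ A)) : BondConfig V) ∅ + clusterCount (↑(γ ∪ B) : BondConfig V) ∅)) *
          h (γ.erase y) := by
  rw [Finset.sum_powerset_insert hy, add_comm, ← Finset.sum_add_distrib, ← Finset.sum_add_distrib]
  refine Finset.sum_congr rfl fun γ hγ => ?_
  rw [Finset.mem_powerset] at hγ
  have hyγ : y ∉ γ := fun hh => hy (hγ hh)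
  have e1 : insert y N \ γ = insert y (N \ γ) := Finset.insert_sdiff_of_notMem _ hyγ
  have e2 : insert y N \ insert y γ = N \ γ := by
    rw [Finset.insert_sdiff_insert, Finset.sdiff_insert_of_notMem hy]
  have e3 : ∀ X Y : Finset (Sym2 V), insert y X ∪ Y = X ∪ insert y Y := fun X Y => by
    rw [Finset.insert_union, Finset.union_insert]
  rw [e1, e2, Finset.erase_eq_of_notMem hyγ, Finset.erase_insert hyγ]
  simp only [e3]
  ring

omit [Fintype V] in
/-- **THE PAIRING LEMMA (rootless).**  As `FK.twoSidedW_pair_insert_eq` without the root. [cite: Grimmett2006, §1.4 eq. (1.20) (p. 15)] -/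
theorem twoSidedW_pair_insert_rootless_eq (w : ℕ → ℝ) {N : Finset (Sym2 V)} (A B : Finset (Sym2 V)) {y : Sym2 V} (hy : y ∉ N)
    (h : Finset (Sym2 V) → ℝ) :
    ∑ γ ∈ N.powerset,
        (w (clusterCount (↑(γ ∪ insert y A) : BondConfig V) ∅ + clusterCount (↑(N \ γ ∪ B) : BondConfig V) ∅) -
          w (clusterCount (↑(N \ γ ∪ insert y A) : BondConfig V) ∅ + clusterCount (↑(γ ∪ B) : BondConfig V) ∅)) * h γ +
      ∑ γ ∈ N.powerset,
        (w (clusterCount (↑(γ ∪ A) : BondConfig V) ∅ + clusterCount (↑(N \ γ ∪ insert y B) : BondConfig V) ∅) -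
          w (clusterCount (↑(N \ γ ∪ A) : BondConfig V) ∅ + clusterCount (↑(γ ∪ insert y B) : BondConfig V) ∅)) * h γ =
      ∑ γ ∈ (insert y N).powerset,
        (w (clusterCount (↑(γ ∪ A) : BondConfig V) ∅ + clusterCount (↑(insert y N \ γ ∪ B) : BondConfig V) ∅) -
          w (clusterCount (↑(insert y N \ γ ∪ A) : BondConfig V) ∅ + clusterCount (↑(γ ∪ B) : BondConfig V) ∅)) *
          h (γ.erase y) := by
  rw [Finset.sum_powerset_insert hy, add_comm, ← Finset.sum_add_distrib, ← Finset.sum_add_distrib]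
  refine Finset.sum_congr rfl fun γ hγ => ?_
  rw [Finset.mem_powerset] at hγ
  have hyγ : y ∉ γ := fun hh => hy (hγ hh)
  have e1 : insert y N \ γ = insert y (N \ γ) := Finset.insert_sdiff_of_notMem _ hyγ
  have e2 : insert y N \ insert y γ = N \ γ := by
    rw [Finset.insert_sdiff_insert, Finset.sdiff_insert_of_notMem hy]
  have e3 : ∀ X Y : Finset (Sym2 V), insert y X ∪ Y = X ∪ insert y Y := fun X Y => by
    rw [Finset.insert_union, Finset.union_insert]
  rw [e1, e2, Finset.erase_eq_of_notMem hyγ, Finset.erase_insert hyγ]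
  simp only [e3]
  ring

omit [Fintype V] in
/-- **The doubled root for a general two-sided drift — the identity.**  `e = uv ∈ N`, `N' = N \ e`: splitting the rooted drift `(A | B)` of `N` by the
`e`-coordinate gives the rooted drift of `N'` against `h(· ∪ e)`, plus the rootless drift of `N'` with `e` inserted on BOTH sides against `h`, plus a
remainder. [cite: Grimmett2006, §1.4 eq. (1.20) (p. 15)] -/
theorem twoSidedW_doubled_eq (w : ℕ → ℝ) {N : Finset (Sym2 V)} (A B : Finset (Sym2 V)) {u v : V} (heN : s(u, v) ∈ N)
    (h : Finset (Sym2 V) → ℝ) :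
    ∑ γ ∈ N.powerset,
        (w (clusterCount (↑(insert s(u, v) (γ ∪ A)) : BondConfig V) ∅ + clusterCount (↑(N \ γ ∪ B) : BondConfig V) ∅) -
          w (clusterCount (↑(insert s(u, v) (N \ γ ∪ A)) : BondConfig V) ∅ + clusterCount (↑(γ ∪ B) : BondConfig V) ∅)) * h γ =
      ∑ γ ∈ (N.erase s(u, v)).powerset,
        (w (clusterCount (↑(insert s(u, v) (γ ∪ A)) : BondConfig V) ∅ + clusterCount (↑(N.erase s(u, v) \ γ ∪ B) : BondConfig V) ∅) -
          w (clusterCount (↑(insert s(u, v) (N.erase s(u, v) \ γ ∪ A)) : BondConfig V) ∅ + clusterCount (↑(γ ∪ B) : BondConfig V) ∅)) *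
          h (insert s(u, v) γ) +
      ∑ γ ∈ (N.erase s(u, v)).powerset,
        (w (clusterCount (↑(insert s(u, v) (γ ∪ A)) : BondConfig V) ∅ +
              clusterCount (↑(insert s(u, v) (N.erase s(u, v) \ γ ∪ B)) : BondConfig V) ∅) -
          w (clusterCount (↑(insert s(u, v) (N.erase s(u, v) \ γ ∪ A)) : BondConfig V) ∅ +
              clusterCount (↑(insert s(u, v) (γ ∪ B)) : BondConfig V) ∅)) * h γ +
      ∑ γ ∈ (N.erase s(u, v)).powerset,
        (w (clusterCount (↑(insert s(u, v) (N.erase s(u, v) \ γ ∪ A)) : BondConfig V) ∅ + clusterCount (↑(γ ∪ B) : BondConfig V) ∅) -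
          w (clusterCount (↑(insert s(u, v) (N.erase s(u, v) \ γ ∪ A)) : BondConfig V) ∅ +
            clusterCount (↑(insert s(u, v) (γ ∪ B)) : BondConfig V) ∅)) * (h (insert s(u, v) γ) - h γ) := by
  set N' := N.erase s(u, v) with hN'
  have hN : N = insert s(u, v) N' := (Finset.insert_erase heN).symm
  have heN' : s(u, v) ∉ N' := Finset.notMem_erase _ _
  rw [hN, Finset.sum_powerset_insert heN']
  have e1 : ∀ γ ∈ N'.powerset, insert s(u, v) N' \ γ = insert s(u, v) (N' \ γ) := fun γ hγ =>
    Finset.insert_sdiff_of_notMem _ (fun hh => heN' (Finset.mem_powerset.1 hγ hh))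
  have e2 : ∀ γ : Finset (Sym2 V), insert s(u, v) N' \ insert s(u, v) γ = N' \ γ := fun γ => by
    rw [Finset.insert_sdiff_insert, Finset.sdiff_insert_of_notMem heN']
  have e3 : ∀ X : Finset (Sym2 V), insert s(u, v) (insert s(u, v) X ∪ A) = insert s(u, v) (X ∪ A) := fun X => by
    rw [Finset.insert_union, Finset.insert_idem]
  have e4 : ∀ X : Finset (Sym2 V), insert s(u, v) X ∪ B = insert s(u, v) (X ∪ B) := fun X => Finset.insert_union _ _ _
  have hS1 : ∑ γ ∈ N'.powerset,
      (w (clusterCount (↑(insert s(u, v) (γ ∪ A)) : BondConfig V) ∅ + clusterCount (↑(insert s(u, v) N' \ γ ∪ B) : BondConfig V) ∅) -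
          w (clusterCount (↑(insert s(u, v) (insert s(u, v) N' \ γ ∪ A)) : BondConfig V) ∅ + clusterCount (↑(γ ∪ B) : BondConfig V) ∅)) *
        h γ =
      ∑ γ ∈ N'.powerset,
      (w (clusterCount (↑(insert s(u, v) (γ ∪ A)) : BondConfig V) ∅ + clusterCount (↑(insert s(u, v) (N' \ γ ∪ B)) : BondConfig V) ∅) -
          w (clusterCount (↑(insert s(u, v) (N' \ γ ∪ A)) : BondConfig V) ∅ + clusterCount (↑(γ ∪ B) : BondConfig V) ∅)) * h γ := by
    refine Finset.sum_congr rfl fun γ hγ => ?_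
    rw [e1 γ hγ, e3, e4]
  have hS2 : ∑ γ ∈ N'.powerset,
      (w (clusterCount (↑(insert s(u, v) (insert s(u, v) γ ∪ A)) : BondConfig V) ∅ +
            clusterCount (↑(insert s(u, v) N' \ insert s(u, v) γ ∪ B) : BondConfig V) ∅) -
          w (clusterCount (↑(insert s(u, v) (insert s(u, v) N' \ insert s(u, v) γ ∪ A)) : BondConfig V) ∅ +
            clusterCount (↑(insert s(u, v) γ ∪ B) : BondConfig V) ∅)) * h (insert s(u, v) γ) =
      ∑ γ ∈ N'.powerset,
      (w (clusterCount (↑(insert s(u, v) (γ ∪ A)) : BondConfig V) ∅ + clusterCount (↑(N' \ γ ∪ B) : BondConfig V) ∅) -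
          w (clusterCount (↑(insert s(u, v) (N' \ γ ∪ A)) : BondConfig V) ∅ +
            clusterCount (↑(insert s(u, v) (γ ∪ B)) : BondConfig V) ∅)) * h (insert s(u, v) γ) := by
    refine Finset.sum_congr rfl fun γ _ => ?_
    rw [e2 γ, e3, e4]
  rw [hS1, hS2, ← Finset.sum_add_distrib, ← Finset.sum_add_distrib, ← Finset.sum_add_distrib]
  refine Finset.sum_congr rfl fun γ _ => ?_
  ring

/-- **The doubled root for a general two-sided drift — the remainder is nonpositive** for every antitone `w` and monotone `h`: inserting `e` on the
second side lowers the cluster count, and `h(γ ∪ e) ≥ h(γ)`. [cite: Grimmett2006, §1.4 eq. (1.20) (p. 15), Thm. (3.1)(a)] -/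
theorem twoSidedW_doubled_rem_nonpos {w : ℕ → ℝ} (hw : ∀ n : ℕ, w (n + 1) ≤ w n) {N : Finset (Sym2 V)} (A B : Finset (Sym2 V)) {u v : V}
    (heN : s(u, v) ∈ N) {h : Finset (Sym2 V) → ℝ} (hmono : ∀ ⦃X Y : Finset (Sym2 V)⦄, X ⊆ Y → Y ⊆ N → h X ≤ h Y) :
    ∑ γ ∈ (N.erase s(u, v)).powerset,
        (w (clusterCount (↑(insert s(u, v) (N.erase s(u, v) \ γ ∪ A)) : BondConfig V) ∅ + clusterCount (↑(γ ∪ B) : BondConfig V) ∅) -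
          w (clusterCount (↑(insert s(u, v) (N.erase s(u, v) \ γ ∪ A)) : BondConfig V) ∅ +
            clusterCount (↑(insert s(u, v) (γ ∪ B)) : BondConfig V) ∅)) * (h (insert s(u, v) γ) - h γ) ≤ 0 := by
  have hanti : ∀ a b : ℕ, a ≤ b → w b ≤ w a := fun a b hab => by
    induction hab with
    | refl => exact le_rfl
    | step _ ih => exact (hw _).trans ih
  have hB : ∀ (Z : ℕ) (X : Finset (Sym2 V)),
      w (Z + clusterCount (↑X : BondConfig V) ∅) ≤ w (Z + clusterCount (↑(insert s(u, v) X) : BondConfig V) ∅) := by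
    intro Z X
    have i := clusterCount_insert_add_ite X u v
    exact hanti _ _ (by omega)
  refine Finset.sum_nonpos fun γ hγ => ?_
  rw [Finset.mem_powerset] at hγ
  exact mul_nonpos_of_nonpos_of_nonneg (sub_nonpos.2 (hB _ (γ ∪ B)))
    (sub_nonneg.2 (hmono (Finset.subset_insert _ _) (Finset.insert_subset heN (hγ.trans (Finset.erase_subset _ _)))))

end OrAttSides

end FK

end Summit.CriticalPhenomena.PercolationContinuityZ3.Theorems

end
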